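import Mathlib
import HarnessLib
import Summits.HubbardSuperconductivity.HubbardSuperconductivity.Theorems.KLProgrammeThinLevelSetTripleCount

/-!
# Route `KLProgramme` — K3 engine (stmt-HubbardSuperconductivity-20437), stub (b) (ℓ)/(I2)–(I3), located item «ABS-UMK-COUNT» / «ABS-UMK-34»:
# two one-dimensional bricks for the INDEFINITE thin level set — the harmonic sum over an `h`-separated set, and a row of bounded slope

Cell gate-hubbard-kl, seat p4 g16 (generic layer of the mixed-sign triple count `card_tripleWindowIndef_le`, file `…ThinLevelSetTripleCountIndef`).

* `sum_inv_sub_le_of_separated` — `Σ_{b ∈ S} 1/(b − τ) ≤ (1 + log(R/h + 1))/h` for an `h`-separated `S ⊂ [τ + h, τ + R]` (the `j`-th point from `τ` is at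
  distance `≥ j·h`; `harmonic_le_one_add_log`);
* `card_row_le_of_slope` — an `h`-separated set on which a function of slope `≥ m > 0` stays in a window of width `2δ′` has `≤ 2δ′/(m h) + 1` points.

Everything is PROVED; no definitions, no named facts; elementary real analysis. [folklore]
-/

noncomputable section

open Real Set Metric

namespace Summit.HubbardSuperconductivity.HubbardSuperconductivity.Theorems.ThinLevelSet

set_option linter.dupNamespace false -- summit = problem name (single-conjunct summit), D-0017

/-! ## §1 The harmonic sum over an `h`-separated set -/

/-- **Harmonic sum over an `h`-separated set on one side of `τ`**: if every `b ∈ S` has `h ≤ b − τ ≤ R` and distinct members of `S` are `≥ h` apart, then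
`Σ_{b ∈ S} 1/(b − τ) ≤ (1 + log(R/h + 1))/h` (the `j`-th point from `τ` is at distance `≥ j·h`). [folklore] -/
theorem sum_inv_sub_le_of_separated {h τ R : ℝ} (hh : 0 < h) (hR : 0 ≤ R) (S : Finset ℝ)
    (hS : ∀ b ∈ S, h ≤ b - τ ∧ b - τ ≤ R) (hsep : ∀ x ∈ S, ∀ y ∈ S, x ≠ y → h ≤ |x - y|) :
    ∑ b ∈ S, 1 / (b - τ) ≤ (1 + Real.log (R / h + 1)) / h := by
  classical
  set j : ℝ → ℕ := fun b => ⌊(b - τ) / h⌋₊ with hj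
  -- each term is dominated by `1/(j(b)·h)` with `j(b) ≥ 1`
  have hjb : ∀ b ∈ S, 1 ≤ j b ∧ (j b : ℝ) * h ≤ b - τ := by
    intro b hb
    obtain ⟨h1, -⟩ := hS b hb
    have hq : 1 ≤ (b - τ) / h := by rw [le_div_iff₀ hh]; linarith
    refine ⟨?_, ?_⟩
    · have := Nat.one_le_floor_iff (x := (b - τ) / h) |>.2 hq
      simpa [hj] using this
    · have hfl : (j b : ℝ) ≤ (b - τ) / h := Nat.floor_le (by linarith)
      rwa [le_div_iff₀ hh] at hfl
  have hterm : ∀ b ∈ S, 1 / (b - τ) ≤ (1 / h) * (1 / (j b : ℝ)) := by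
    intro b hb
    obtain ⟨hj1, hjh⟩ := hjb b hb
    have hjpos : (0 : ℝ) < j b := by exact_mod_cast hj1
    rw [one_div_mul_one_div, one_div_le_one_div (by linarith [(hS b hb).1]) (by positivity)]
    linarith
  -- `j` is injective on `S`
  have hlt : ∀ x ∈ S, ∀ y ∈ S, x < y → j x < j y := by
    intro x hx y hy hxy
    have hd : h ≤ y - x := by
      have := hsep x hx y hy hxy.ne
      rwa [abs_sub_comm, abs_of_pos (sub_pos.2 hxy)] at this
    have hx0 : 0 ≤ (x - τ) / h := div_nonneg (by linarith [(hS x hx).1]) hh.le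
    have h1 : (x - τ) / h + 1 ≤ (y - τ) / h := by
      rw [div_add_one hh.ne', div_le_div_iff_of_pos_right hh]; linarith
    have h2 : j x + 1 ≤ j y := by
      rw [hj]
      show ⌊(x - τ) / h⌋₊ + 1 ≤ ⌊(y - τ) / h⌋₊
      rw [← Nat.floor_add_one hx0]
      exact Nat.floor_le_floor h1
    omega
  have hinj : Set.InjOn j S := by
    intro x hx y hy hxy
    by_contra hne
    rcases lt_or_gt_of_ne hne with hlt' | hlt'
    · exact absurd hxy (hlt x hx y hy hlt').ne
    · exact absurd hxy (hlt y hy x hx hlt').ne'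
  -- the image lies in `[1, J]`, `J = ⌊R/h⌋`
  set J : ℕ := ⌊R / h⌋₊ with hJ
  have himg : S.image j ⊆ Finset.Icc 1 J := by
    intro n hn
    rw [Finset.mem_image] at hn
    obtain ⟨b, hb, rfl⟩ := hn
    rw [Finset.mem_Icc]
    refine ⟨(hjb b hb).1, ?_⟩
    rw [hj, hJ]
    exact Nat.floor_le_floor (div_le_div_of_nonneg_right (hS b hb).2 hh.le)
  -- the harmonic bound
  have hharm : ∑ n ∈ Finset.Icc 1 J, (1 / (n : ℝ)) ≤ 1 + Real.log (R / h + 1) := by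
    have h1 := harmonic_le_one_add_log J
    simp only [harmonic_eq_sum_Icc, Rat.cast_sum, Rat.cast_inv, Rat.cast_natCast] at h1
    have h2 : Real.log (J : ℝ) ≤ Real.log (R / h + 1) := by
      by_cases hJ0 : J = 0
      · rw [hJ0, Nat.cast_zero, Real.log_zero]; exact Real.log_nonneg (by linarith [div_nonneg hR hh.le])
      · refine Real.log_le_log (by exact_mod_cast Nat.pos_of_ne_zero hJ0) ?_
        have : (J : ℝ) ≤ R / h := Nat.floor_le (div_nonneg hR hh.le)
        linarith
    calc ∑ n ∈ Finset.Icc 1 J, (1 / (n : ℝ)) = ∑ n ∈ Finset.Icc 1 J, ((n : ℝ))⁻¹ := by simp [one_div]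
      _ ≤ 1 + Real.log J := h1
      _ ≤ 1 + Real.log (R / h + 1) := by linarith
  calc ∑ b ∈ S, 1 / (b - τ) ≤ ∑ b ∈ S, (1 / h) * (1 / (j b : ℝ)) := Finset.sum_le_sum hterm
    _ = (1 / h) * ∑ b ∈ S, (1 / (j b : ℝ)) := by rw [Finset.mul_sum]
    _ = (1 / h) * ∑ n ∈ S.image j, (1 / (n : ℝ)) := by rw [Finset.sum_image hinj]
    _ ≤ (1 / h) * ∑ n ∈ Finset.Icc 1 J, (1 / (n : ℝ)) := by
        refine mul_le_mul_of_nonneg_left ?_ (by positivity)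
        exact Finset.sum_le_sum_of_subset_of_nonneg himg fun n _ _ => by positivity
    _ ≤ (1 / h) * (1 + Real.log (R / h + 1)) := mul_le_mul_of_nonneg_left hharm (by positivity)
    _ = (1 + Real.log (R / h + 1)) / h := by ring

/-! ## §2 A row: a function of slope `≥ m` on an `h`-separated set -/

/-- **A row of the indefinite window**: if `|φ y − φ x| ≥ m·(y − x)` for `x ≤ y` in `S` (`m > 0`) and `|φ − β| ≤ δ′` on the `h`-separated set `S`, then
`#S ≤ 2δ′/(m h) + 1`. [folklore] -/
theorem card_row_le_of_slope {φ : ℝ → ℝ} {m h δ' β : ℝ} (hm : 0 < m) (hh : 0 < h) (hδ' : 0 ≤ δ') (S : Finset ℝ)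
    (hslope : ∀ x ∈ S, ∀ y ∈ S, x ≤ y → m * (y - x) ≤ |φ y - φ x|) (hwin : ∀ x ∈ S, |φ x - β| ≤ δ')
    (hsep : ∀ x ∈ S, ∀ y ∈ S, x ≠ y → h ≤ |x - y|) : (S.card : ℝ) ≤ 2 * δ' / (m * h) + 1 := by
  classical
  rcases S.eq_empty_or_nonempty with hS | hS
  · rw [hS, Finset.card_empty, Nat.cast_zero]; positivity
  set a₀ := S.min' hS with ha₀
  have hmem : ∀ x ∈ S, x ∈ Icc a₀ (a₀ + 2 * δ' / m) := by
    intro x hx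
    have hle : a₀ ≤ x := S.min'_le x hx
    refine ⟨hle, ?_⟩
    have h1 := hslope a₀ (S.min'_mem hS) x hx hle
    have h2 : |φ x - φ a₀| ≤ 2 * δ' := by
      have e : φ x - φ a₀ = (φ x - β) - (φ a₀ - β) := by ring
      rw [e]
      exact (abs_sub _ _).trans (by linarith [hwin x hx, hwin a₀ (S.min'_mem hS)])
    have h3 : m * (x - a₀) ≤ 2 * δ' := h1.trans h2
    rw [← sub_le_iff_le_add', le_div_iff₀ hm]; linarith
  have hab : a₀ ≤ a₀ + 2 * δ' / m := by
    have : 0 ≤ 2 * δ' / m := by positivity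
    linarith
  have hcnt := card_le_of_separated_subset_Icc hh hab S hmem hsep
  have e : (a₀ + 2 * δ' / m - a₀) / h + 1 = 2 * δ' / (m * h) + 1 := by
    field_simp
    ring
  rwa [e] at hcnt


end Summit.HubbardSuperconductivity.HubbardSuperconductivity.Theorems.ThinLevelSet

end
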